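import Literature.Geometry.Kaehler.ComplexTorusSchollCorrespondenceInverseLefschetz
import Literature.Geometry.Kaehler.ComplexTorusInvariantFormsAddition
import HarnessLib

/-!
# Scholl's correspondences `p_i`, `f_i` are Lefschetz (divisor-polynomial) classes on `X × X`, and Kleiman's
# `Λ^{g-i}` is the action of an explicit divisor-class correspondence (Milne 1999, Thm. 5.10 / Rem. 5.11, torus level)

Layer `Literature/Geometry/Kaehler`, namespace `Literature.Geometry.Kaehler.ComplexTorus`; lane `lit-hodgefound`
(Track 2 foundations library), Layer A4, prover seat `lit-hodgefound-p08` (generation 11, self-proposed row g11-#3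
«(g11-#1)⁺ · (g11-#2)⁺ · A4-29⁺ · (g7-#1)⁺ · (p09 `realRep_addMatrix_eq_fst_add_snd`)⁺»). Sequel, BY NAME, of
`ComplexTorusKunnethDiagonalDivisorFormula` (g11-#1: the monomials `(of 2 p₁^*θ)^a (of 2 p₂^*θ)^b (of 2 μ)^n` of the
graded ring `GForm (E × E) ℂ` and their read-out as forms, `monomial_apply_eq_domDomCongr`, `isHomog_monomial`),
`ComplexTorusSchollCorrespondenceInverseLefschetz` (g11-#2: `((-1)ⁱ g!/c) · f_i(·) = Λᵗ`,
`smul_corrAct_schollF_eq_kleimanDualPow`), `ComplexTorusDivisorClasses` / `ComplexTorusDivisorClassesRing` (A4-29: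
`Dᵖ(X)`, the `ℚ`-span of `p`-fold wedges of Néron–Severi classes; `wedgePow_mem_divisorClasses`,
`wedge_mem_divisorClasses`), `ComplexTorusDivisorClassesIsogeny` (`IsNSForm.comp_realRep`: `NS` is stable under
pull-back by homomorphisms), `ComplexTorusGraphClassesLefschetz` (g7-#1: `IsNSForm.comp_snd`) and
`ComplexTorusInvariantFormsAddition` (p09: `ρ(m) = p₁ + p₂`).

## Source, verbatim

J. S. Milne, *Lefschetz classes on abelian varieties*, Duke Math. J. **96** (1999) 639–675, held
`paper:doi-10-1215-s0012-7094-99-09620-5`, p. 665 (p0027 L16–L52): proof of **Theorem 5.10**: "Choose a symmetric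
ample divisor `D` on `A`, and let `M = m^*D − p^*D − q^*D`. … define
`p_i = ((−1)ⁱ/deg(λ_D)) Σ_{max(0,i−g) ≤ j ≤ i/2} (1/(j!(g−i+j)!(i−2j)!)) p^*([D^{g−i+j}]) · q^*([Dʲ]) · [M]^{i−2j}`. …
Clearly each `p_i` is a Lefschetz class"; and (L54–L79) **Remark 5.11**: "… it is possible to show similarly that the
correspondences `Λ`, `ᶜΛ`, `∗` etc. are Lefschetz for rational equivalence. Following (Scholl 1994, 5.9), define
`f_i = Σ_{max(0,i−g) ≤ j ≤ i/2} (1/(j!(g−i+j)!(i−2j)!)) p^*([Dʲ]) · q^*([Dʲ]) · [M]^{i−2j}`. Then `f_i` is Lefschetz,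
and `((−1)ⁱ/√deg(λ_D)) f_i` is the inverse of the strong Lefschetz isomorphism 'cup with `[D]^{g−i}`'."
A *Lefschetz class* is an element of the `ℚ`-algebra generated by divisor classes (Milne, Introduction; at torus
level the tree's `divisorClasses Ψ p = Dᵖ`, Lange 2023 §7.3.1 "the subring `D•(X)` of `H^{2•}_Hodge(X)` generated by
`H⁰_Hodge` and `H²_Hodge`").

## What is proved (torus level; theorems only, no definitions, no named facts)

For a complex torus `X = E/Φ(ℤ^ι)`, `η ∈ NS(X)` (`IsNSForm Φ η`: type `(1,1)`, integral on `Λ`), `θ := ofRealForm η`,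
`μ := m^*θ − p₁^*θ − p₂^*θ` on `X × X` (`m = p₁ + p₂` the addition map):
* §0 `IsNSForm.comp_fst` (`p₁^*η ∈ NS(X × X)`), `IsNSForm.comp_fst_add_snd` (`m^*η ∈ NS(X × X)`),
  **`IsNSForm.mixedForm`** (Mumford's `[M]`: `m^*η − p₁^*η − p₂^*η ∈ NS(X × X)`).
* §1 **`IsNSForm.monomial_apply_mem_divisorClasses`**: `p₁^*θ^{∧a} ∧ p₂^*θ^{∧b} ∧ μ^{∧n} ∈ D^{a+b+n}(X × X)` (the
  degree-`2(a+b+n)` component of the monomial of the graded ring); hence, the coefficients being rational,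
  **`IsNSForm.schollF_apply_mem_divisorClasses`**: `(f_i)_{2i} ∈ Dⁱ(X × X)` ("`f_i` is Lefschetz") and
  **`IsNSForm.schollProjectorSum_apply_mem_divisorClasses`**: `(Σ_j (…) p₁^*θ^{g−i+j} p₂^*θ^j μ^{i−2j})_{2g} ∈ Dᵍ(X × X)`
  ("each `p_i` is a Lefschetz class" — with g11-#1's `p_i = of (2g) π_i` an explicit re-proof of Cor. 5.8
  `π_i ∈ Dᵍ(X × X)`); `schollF_apply_add_self_eq_domDomCongr`: `(f_i)_{i+i}` is `(f_i)_{2i}` re-indexed.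
* §2 **`IsNSForm.exists_mem_divisorClasses_smul_corrAct_eq_kleimanDualPow`**: for `η ∈ NS(X)` non-degenerate with
  `θ^{∧g} = c · vol_X`, `c ≠ 0`, and `i + t = g`, there is an EXPLICIT `γ ∈ Dⁱ(X × X)` (namely `(f_i)_{2i}`) with
  `((−1)ⁱ g!/c) · γ(·) = Λᵗ = kleimanDualPow η i t : H^{2g−i}(X) → Hⁱ(X)` — Kleiman's inverse Lefschetz operator is the
  action (Lange (6.6), `corrAct`) of a Lefschetz correspondence ("the correspondences `Λ`, … are Lefschetz", read in
  cohomology); polarised, in the printed normalisation (`√deg(λ_L) = d₁⋯d_g`, `ω = c₁(L) = ofRealForm (−η)`):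
  **`IsRiemannForm.exists_mem_divisorClasses_smul_corrAct_eq_kleimanDualPow`**: `((−1)ⁱ/(d₁⋯d_g)) · γ(·) = Λ^{g−i}`.

NOT here: Chow groups / rational equivalence; `ᶜΛ`, `∗` (g6 `ComplexTorusLefschetzDualCorrespondence` gives `ᶜΛ` as
a divisor-class correspondence; `∗` would follow from Milne's `∗ = ` polynomial in `L`, `Λ`).

## References

* [Milne1999LefschetzClasses] J. S. Milne, *Lefschetz classes on abelian varieties*, Duke Math. J. 96 (1999),
  §5 Thm. 5.10 (proof), Rem. 5.11 (p. 665).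
* [Lange2023AbelianVarietiesComplex] H. Lange, *Abelian Varieties over the Complex Numbers* (2023), §7.3.1 (`D•(X)`),
  §6.2.2 (6.6), §2.5.3 (the addition map), §1.3.1 (1.10).
* [Kleiman1968AlgebraicCycles] S. L. Kleiman, *Algebraic cycles and the Weil conjectures* (1968), §1.4.
-/

noncomputable section

open scoped Manifold ContDiff Topology Real
open Set Function Complex Finset Module
open Literature.LinearAlgebra.Alternating
open Literature.LinearAlgebra.Alternating.GForm (of IsHomog)

namespace Literature.Geometry.Kaehler

namespace ComplexTorus

/-! ### §0 The three generators `p₁^*η`, `m^*η`, `μ = m^*η - p₁^*η - p₂^*η` are Néron–Severi classes of `X × X` -/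

section NS

variable {ι : Type*} [Fintype ι] [DecidableEq ι] {E : Type*} [NormedAddCommGroup E] [NormedSpace ℂ E]
  (Φ : (ι → ℝ) ≃L[ℝ] E)

omit [Fintype ι] [DecidableEq ι] in
/-- `NS` is closed under subtraction. [cite: Lange2023AbelianVarietiesComplex, §1.3.1 (1.10)] -/
private theorem isNSForm_sub' {κ : Type*} {V : Type*} [NormedAddCommGroup V] [NormedSpace ℂ V]
    (Ψ : (κ → ℝ) ≃L[ℝ] V) {η₁ η₂ : V [⋀^Fin 2]→L[ℝ] ℝ} (h₁ : IsNSForm Ψ η₁) (h₂ : IsNSForm Ψ η₂) :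
    IsNSForm Ψ (η₁ - η₂) where
  type_one_one u v := by
    simp only [ContinuousAlternatingMap.sub_apply, h₁.type_one_one, h₂.type_one_one]
  integral m n := by
    obtain ⟨k₁, hk₁⟩ := h₁.integral m n
    obtain ⟨k₂, hk₂⟩ := h₂.integral m n
    exact ⟨k₁ - k₂, by rw [ContinuousAlternatingMap.sub_apply, hk₁, hk₂, Int.cast_sub]⟩

omit [Fintype ι] [DecidableEq ι] in
/-- `NS` is closed under negation. [cite: Lange2023AbelianVarietiesComplex, §1.3.1 (1.10)] -/
private theorem isNSForm_neg' {κ : Type*} {V : Type*} [NormedAddCommGroup V] [NormedSpace ℂ V]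
    (Ψ : (κ → ℝ) ≃L[ℝ] V) {η₁ : V [⋀^Fin 2]→L[ℝ] ℝ} (h₁ : IsNSForm Ψ η₁) : IsNSForm Ψ (-η₁) where
  type_one_one u v := by simp only [ContinuousAlternatingMap.neg_apply, h₁.type_one_one]
  integral m n := by
    obtain ⟨k₁, hk₁⟩ := h₁.integral m n
    exact ⟨-k₁, by rw [ContinuousAlternatingMap.neg_apply, hk₁, Int.cast_neg]⟩

/-- `p₁^*η ∈ NS(X × X)` for `η ∈ NS(X)` (pull-back along the projection, `ρ(p₁) = (1 0)`).
[cite: Milne1999LefschetzClasses, §5 Thm. 5.10 (proof)] -/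
theorem IsNSForm.comp_fst {η : E [⋀^Fin 2]→L[ℝ] ℝ} (hη : IsNSForm Φ η) :
    IsNSForm (prodPeriod Φ Φ) (η.compContinuousLinearMap (ContinuousLinearMap.fst ℝ E E)) := by
  have h := IsNSForm.comp_realRep (prodPeriod Φ Φ) Φ (fstMatrix ι ι) (fun c u ↦ by
    rw [realRep_fstMatrix]; rfl) hη
  rwa [realRep_fstMatrix] at h

/-- `m^*η ∈ NS(X × X)` for `η ∈ NS(X)` (pull-back along the addition map `m = p₁ + p₂`, `ρ(m) = (1 1)`).
[cite: Milne1999LefschetzClasses, §5 Thm. 5.10 (proof)] -/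
theorem IsNSForm.comp_fst_add_snd {η : E [⋀^Fin 2]→L[ℝ] ℝ} (hη : IsNSForm Φ η) :
    IsNSForm (prodPeriod Φ Φ)
      (η.compContinuousLinearMap (ContinuousLinearMap.fst ℝ E E + ContinuousLinearMap.snd ℝ E E)) := by
  have h := IsNSForm.comp_realRep (prodPeriod Φ Φ) Φ (addMatrix ι) (fun c u ↦ by
    rw [realRep_addMatrix, realRep_addMatrix, Prod.smul_fst, Prod.smul_snd, smul_add]) hη
  rwa [realRep_addMatrix_eq_fst_add_snd] at h

/-- **Mumford's class `[M]`, `M = m^*D - p^*D - q^*D`, is a divisor class**: the mixed form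
`μ = m^*η - p₁^*η - p₂^*η ∈ NS(X × X)` for `η ∈ NS(X)`. [cite: Milne1999LefschetzClasses, §5 Thm. 5.10 (proof)] -/
theorem IsNSForm.mixedForm {η : E [⋀^Fin 2]→L[ℝ] ℝ} (hη : IsNSForm Φ η) :
    IsNSForm (prodPeriod Φ Φ)
      (η.compContinuousLinearMap (ContinuousLinearMap.fst ℝ E E + ContinuousLinearMap.snd ℝ E E) -
        η.compContinuousLinearMap (ContinuousLinearMap.fst ℝ E E) -
        η.compContinuousLinearMap (ContinuousLinearMap.snd ℝ E E)) := by
  exact isNSForm_sub' _ (isNSForm_sub' _ (hη.comp_fst_add_snd Φ) (hη.comp_fst Φ)) (hη.comp_snd Φ)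

end NS

/-! ### §1 "Clearly each `p_i` is a Lefschetz class", "`f_i` is Lefschetz": the monomials are divisor classes -/

section Lefschetz

variable {ι : Type*} [Fintype ι] [DecidableEq ι] {E : Type*} [NormedAddCommGroup E] [NormedSpace ℂ E]
  (Φ : (ι → ℝ) ≃L[ℝ] E) {η : E [⋀^Fin 2]→L[ℝ] ℝ}

omit [Fintype ι] [DecidableEq ι] in
/-- `Dᵖ ∧ D^q ⊆ Dʳ` along any cast `2p + 2q = 2r`. [cite: Lange2023AbelianVarietiesComplex, §7.3.1] -/
private theorem wedge_domDomCongr_mem_divisorClasses {κ : Type*} {V : Type*} [NormedAddCommGroup V]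
    [NormedSpace ℂ V] (Ψ : (κ → ℝ) ≃L[ℝ] V) {p q r : ℕ} (h : 2 * p + 2 * q = 2 * r)
    {γ : V [⋀^Fin (2 * p)]→L[ℝ] ℂ} {δ : V [⋀^Fin (2 * q)]→L[ℝ] ℂ} (hγ : γ ∈ divisorClasses Ψ p)
    (hδ : δ ∈ divisorClasses Ψ q) : (γ.wedge δ).domDomCongr (finCongr h) ∈ divisorClasses Ψ r := by
  obtain rfl : r = p + q := by omega
  exact wedge_mem_divisorClasses Ψ hγ hδ

/-- **The monomials are Lefschetz classes**: for `η ∈ NS(X)`, `θ = ofRealForm η`, the degree-`2(a+b+n)` component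
of `(of 2 p₁^*θ)^a (of 2 p₂^*θ)^b (of 2 μ)^n`, i.e. the form `p₁^*θ^{∧a} ∧ p₂^*θ^{∧b} ∧ μ^{∧n}`, lies in
`D^{a+b+n}(X × X)` — `p₁^*η`, `p₂^*η`, `μ ∈ NS(X × X)` and `D•` is a ring (Lange §7.3.1).
[cite: Milne1999LefschetzClasses, §5 Thm. 5.10 (proof: "Clearly each `p_i` is a Lefschetz class")] -/
theorem IsNSForm.monomial_apply_mem_divisorClasses (hη : IsNSForm Φ η) (a b n : ℕ) :
    ((of 2 ((ofRealForm η).compContinuousLinearMap (ContinuousLinearMap.fst ℝ E E)) : GForm (E × E) ℂ) ^ a *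
          of 2 ((ofRealForm η).compContinuousLinearMap (ContinuousLinearMap.snd ℝ E E)) ^ b *
          of 2 (((ofRealForm η).compContinuousLinearMap (ContinuousLinearMap.fst ℝ E E +
              ContinuousLinearMap.snd ℝ E E)) -
            ((ofRealForm η).compContinuousLinearMap (ContinuousLinearMap.fst ℝ E E)) -
            ((ofRealForm η).compContinuousLinearMap (ContinuousLinearMap.snd ℝ E E))) ^ n) (2 * (a + b + n)) ∈
      divisorClasses (prodPeriod Φ Φ) (a + b + n) := by
  rw [monomial_apply_eq_domDomCongr (ofRealForm η) (by ring : 2 * a + 2 * b + 2 * n = 2 * (a + b + n))]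
  have hA : wedgePow ((ofRealForm η).compContinuousLinearMap (ContinuousLinearMap.fst ℝ E E)) a ∈
      divisorClasses (prodPeriod Φ Φ) a := by
    rw [← ofRealForm_compContinuousLinearMap]
    exact wedgePow_mem_divisorClasses _ (hη.comp_fst Φ) a
  have hB : wedgePow ((ofRealForm η).compContinuousLinearMap (ContinuousLinearMap.snd ℝ E E)) b ∈
      divisorClasses (prodPeriod Φ Φ) b := by
    rw [← ofRealForm_compContinuousLinearMap]
    exact wedgePow_mem_divisorClasses _ (hη.comp_snd Φ) b
  have hU : wedgePow (((ofRealForm η).compContinuousLinearMap (ContinuousLinearMap.fst ℝ E E +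
        ContinuousLinearMap.snd ℝ E E)) -
      ((ofRealForm η).compContinuousLinearMap (ContinuousLinearMap.fst ℝ E E)) -
      ((ofRealForm η).compContinuousLinearMap (ContinuousLinearMap.snd ℝ E E))) n ∈
      divisorClasses (prodPeriod Φ Φ) n := by
    have hμ : ((ofRealForm η).compContinuousLinearMap (ContinuousLinearMap.fst ℝ E E +
          ContinuousLinearMap.snd ℝ E E)) -
        ((ofRealForm η).compContinuousLinearMap (ContinuousLinearMap.fst ℝ E E)) -
        ((ofRealForm η).compContinuousLinearMap (ContinuousLinearMap.snd ℝ E E)) =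
        ofRealForm (η.compContinuousLinearMap (ContinuousLinearMap.fst ℝ E E + ContinuousLinearMap.snd ℝ E E) -
          η.compContinuousLinearMap (ContinuousLinearMap.fst ℝ E E) -
          η.compContinuousLinearMap (ContinuousLinearMap.snd ℝ E E)) := by
      ext v; simp
    rw [hμ]
    exact wedgePow_mem_divisorClasses _ (hη.mixedForm Φ) n
  have hABU := wedge_domDomCongr_mem_divisorClasses (prodPeriod Φ Φ)
    (by ring : 2 * (a + b) + 2 * n = 2 * (a + b + n))
    (wedge_domDomCongr_mem_divisorClasses (prodPeriod Φ Φ) (by ring : 2 * a + 2 * b = 2 * (a + b)) hA hB) hU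
  rwa [domDomCongr_finCongr_wedge, domDomCongr_finCongr_trans] at hABU

variable {g : ℕ}

/-- **"`f_i` is Lefschetz" (Milne 1999, Rem. 5.11), at torus level**: for `η ∈ NS(X)` the degree-`2i` component of
Scholl's `f_i = Σ_{max(0,i-g) ≤ j ≤ i/2} (1/(j!(g-i+j)!(i-2j)!)) (of 2 p₁^*θ)^j (of 2 p₂^*θ)^j (of 2 μ)^{i-2j}`
(`θ = ofRealForm η`) lies in `Dⁱ(X × X)`, the `ℚ`-span of `i`-fold wedges of Néron–Severi classes of `X × X`.
[cite: Milne1999LefschetzClasses, §5 Rem. 5.11] -/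
theorem IsNSForm.schollF_apply_mem_divisorClasses (hη : IsNSForm Φ η) (i : ℕ) :
    ((∑ j ∈ Finset.Icc (i - g) (i / 2),
          ((Nat.factorial j * Nat.factorial (g + j - i) * Nat.factorial (i - 2 * j) : ℕ) : ℂ)⁻¹ •
            ((of 2 ((ofRealForm η).compContinuousLinearMap (ContinuousLinearMap.fst ℝ E E)) : GForm (E × E) ℂ) ^ j *
          of 2 ((ofRealForm η).compContinuousLinearMap (ContinuousLinearMap.snd ℝ E E)) ^ j *
          of 2 (((ofRealForm η).compContinuousLinearMap (ContinuousLinearMap.fst ℝ E E +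
              ContinuousLinearMap.snd ℝ E E)) -
            ((ofRealForm η).compContinuousLinearMap (ContinuousLinearMap.fst ℝ E E)) -
            ((ofRealForm η).compContinuousLinearMap (ContinuousLinearMap.snd ℝ E E))) ^ (i - 2 * j))) :
        GForm (E × E) ℂ) (2 * i) ∈ divisorClasses (prodPeriod Φ Φ) i := by
  rw [Finset.sum_apply]
  refine Submodule.sum_mem _ fun j hj ↦ ?_
  obtain ⟨-, hj2⟩ := Finset.mem_Icc.mp hj
  have hm := hη.monomial_apply_mem_divisorClasses Φ j j (i - 2 * j)
  rw [show j + j + (i - 2 * j) = i by omega] at hm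
  rw [Pi.smul_apply, show ((Nat.factorial j * Nat.factorial (g + j - i) * Nat.factorial (i - 2 * j) : ℕ) : ℂ)⁻¹ =
      ((((Nat.factorial j * Nat.factorial (g + j - i) * Nat.factorial (i - 2 * j) : ℕ) : ℚ)⁻¹ : ℚ) : ℂ) by
    rw [Rat.cast_inv, Rat.cast_natCast], Rat.cast_smul_eq_qsmul]
  exact Submodule.smul_mem _ _ hm

/-- **"Clearly each `p_i` is a Lefschetz class" (Milne 1999, proof of Thm. 5.10), at torus level**: for `η ∈ NS(X)`
and every `i` the degree-`2g` component of
`Σ_{max(0,i-g) ≤ j ≤ i/2} (1/(j!(g-i+j)!(i-2j)!)) (of 2 p₁^*θ)^{g-i+j} (of 2 p₂^*θ)^j (of 2 μ)^{i-2j}` lies in `Dᵍ(X × X)`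
(so does `p_i`, a rational multiple; with g11-#1 this re-proves Cor. 5.8 `π_i ∈ Dᵍ(X × X)` by an explicit formula).
[cite: Milne1999LefschetzClasses, §5 Thm. 5.10 (proof)] -/
theorem IsNSForm.schollProjectorSum_apply_mem_divisorClasses (hη : IsNSForm Φ η) (i : ℕ) :
    ((∑ j ∈ Finset.Icc (i - g) (i / 2),
          ((Nat.factorial j * Nat.factorial (g + j - i) * Nat.factorial (i - 2 * j) : ℕ) : ℂ)⁻¹ •
            ((of 2 ((ofRealForm η).compContinuousLinearMap (ContinuousLinearMap.fst ℝ E E)) : GForm (E × E) ℂ) ^ (g + j - i) *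
          of 2 ((ofRealForm η).compContinuousLinearMap (ContinuousLinearMap.snd ℝ E E)) ^ j *
          of 2 (((ofRealForm η).compContinuousLinearMap (ContinuousLinearMap.fst ℝ E E +
              ContinuousLinearMap.snd ℝ E E)) -
            ((ofRealForm η).compContinuousLinearMap (ContinuousLinearMap.fst ℝ E E)) -
            ((ofRealForm η).compContinuousLinearMap (ContinuousLinearMap.snd ℝ E E))) ^ (i - 2 * j))) :
        GForm (E × E) ℂ) (2 * g) ∈ divisorClasses (prodPeriod Φ Φ) g := by
  rw [Finset.sum_apply]
  refine Submodule.sum_mem _ fun j hj ↦ ?_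
  obtain ⟨hj1, hj2⟩ := Finset.mem_Icc.mp hj
  have hm := hη.monomial_apply_mem_divisorClasses Φ (g + j - i) j (i - 2 * j)
  rw [show g + j - i + j + (i - 2 * j) = g by omega] at hm
  rw [Pi.smul_apply, show ((Nat.factorial j * Nat.factorial (g + j - i) * Nat.factorial (i - 2 * j) : ℕ) : ℂ)⁻¹ =
      ((((Nat.factorial j * Nat.factorial (g + j - i) * Nat.factorial (i - 2 * j) : ℕ) : ℚ)⁻¹ : ℚ) : ℂ) by
    rw [Rat.cast_inv, Rat.cast_natCast], Rat.cast_smul_eq_qsmul]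
  exact Submodule.smul_mem _ _ hm

/-- The degree-`(i+i)` reading of `f_i` used by the action (6.6) is the degree-`2i` component re-indexed
(`f_i` is homogeneous of degree `2i`). [cite: Milne1999LefschetzClasses, §5 Rem. 5.11] -/
theorem schollF_apply_add_self_eq_domDomCongr (ξ : E [⋀^Fin 2]→L[ℝ] ℝ) (i : ℕ) :
    ((∑ j ∈ Finset.Icc (i - g) (i / 2),
          ((Nat.factorial j * Nat.factorial (g + j - i) * Nat.factorial (i - 2 * j) : ℕ) : ℂ)⁻¹ •
            ((of 2 ((ofRealForm ξ).compContinuousLinearMap (ContinuousLinearMap.fst ℝ E E)) : GForm (E × E) ℂ) ^ j *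
          of 2 ((ofRealForm ξ).compContinuousLinearMap (ContinuousLinearMap.snd ℝ E E)) ^ j *
          of 2 (((ofRealForm ξ).compContinuousLinearMap (ContinuousLinearMap.fst ℝ E E +
              ContinuousLinearMap.snd ℝ E E)) -
            ((ofRealForm ξ).compContinuousLinearMap (ContinuousLinearMap.fst ℝ E E)) -
            ((ofRealForm ξ).compContinuousLinearMap (ContinuousLinearMap.snd ℝ E E))) ^ (i - 2 * j))) :
        GForm (E × E) ℂ) (i + i) = (((∑ j ∈ Finset.Icc (i - g) (i / 2),
          ((Nat.factorial j * Nat.factorial (g + j - i) * Nat.factorial (i - 2 * j) : ℕ) : ℂ)⁻¹ •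
            ((of 2 ((ofRealForm ξ).compContinuousLinearMap (ContinuousLinearMap.fst ℝ E E)) : GForm (E × E) ℂ) ^ j *
          of 2 ((ofRealForm ξ).compContinuousLinearMap (ContinuousLinearMap.snd ℝ E E)) ^ j *
          of 2 (((ofRealForm ξ).compContinuousLinearMap (ContinuousLinearMap.fst ℝ E E +
              ContinuousLinearMap.snd ℝ E E)) -
            ((ofRealForm ξ).compContinuousLinearMap (ContinuousLinearMap.fst ℝ E E)) -
            ((ofRealForm ξ).compContinuousLinearMap (ContinuousLinearMap.snd ℝ E E))) ^ (i - 2 * j))) :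
        GForm (E × E) ℂ) (2 * i)).domDomCongr (finCongr (two_mul i)) := by
  set F : GForm (E × E) ℂ := ((∑ j ∈ Finset.Icc (i - g) (i / 2),
          ((Nat.factorial j * Nat.factorial (g + j - i) * Nat.factorial (i - 2 * j) : ℕ) : ℂ)⁻¹ •
            ((of 2 ((ofRealForm ξ).compContinuousLinearMap (ContinuousLinearMap.fst ℝ E E)) : GForm (E × E) ℂ) ^ j *
          of 2 ((ofRealForm ξ).compContinuousLinearMap (ContinuousLinearMap.snd ℝ E E)) ^ j *
          of 2 (((ofRealForm ξ).compContinuousLinearMap (ContinuousLinearMap.fst ℝ E E +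
              ContinuousLinearMap.snd ℝ E E)) -
            ((ofRealForm ξ).compContinuousLinearMap (ContinuousLinearMap.fst ℝ E E)) -
            ((ofRealForm ξ).compContinuousLinearMap (ContinuousLinearMap.snd ℝ E E))) ^ (i - 2 * j))) :
        GForm (E × E) ℂ) with hFdef
  have hF : IsHomog (2 * i) F := by
    refine GForm.IsHomog.sum _ fun j hj ↦ ?_
    obtain ⟨-, hj2⟩ := Finset.mem_Icc.mp hj
    have hm := isHomog_monomial (ofRealForm ξ) j j (i - 2 * j)
    rw [show 2 * j + 2 * j + 2 * (i - 2 * j) = 2 * i by omega] at hm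
    exact hm.smul _
  have h := congrFun hF.eq_of (i + i)
  rwa [← GForm.of_domDomCongr_finCongr (two_mul i), GForm.of_apply_self] at h

end Lefschetz

/-! ### §2 Kleiman's `Λ^{g-i}` is the action of an explicit divisor-class (Lefschetz) correspondence -/

section Kleiman

variable {ι : Type*} [Fintype ι] [DecidableEq ι] {E : Type*} [NormedAddCommGroup E] [NormedSpace ℂ E]
  [FiniteDimensional ℂ E] (Φ : (ι → ℝ) ≃L[ℝ] E) {g : ℕ} (e : Fin (2 * g) ≃ ι) {η : E [⋀^Fin 2]→L[ℝ] ℝ}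

/-- **THEOREM (Milne 1999, Rem. 5.11 — "the correspondences `Λ`, … are Lefschetz", at torus level).** For a complex
torus `X` of dimension `g` with a non-degenerate Néron–Severi class `η` (`θ = ofRealForm η`, `θ^{∧g} = c·vol_X`,
`c ≠ 0`) and `i + t = g`, Kleiman's inverse Lefschetz operator `Λᵗ : H^{2g-i}(X) → Hⁱ(X)` is the action (6.6) of an
EXPLICIT DIVISOR CLASS `γ ∈ Dⁱ(X × X)` (a `ℚ`-polynomial in `p₁^*η`, `p₂^*η`, `m^*η`), up to the scalar `(-1)ⁱ g!/c`:
`γ = (f_i)_{2i}` Scholl's correspondence. [cite: Milne1999LefschetzClasses, §5 Rem. 5.11] -/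
theorem IsNSForm.exists_mem_divisorClasses_smul_corrAct_eq_kleimanDualPow (hη : IsNSForm Φ η)
    (hnd : ∀ v : E, v ≠ 0 → ∃ w : E, η ![v, w] ≠ 0) {c : ℂ} (hc : wedgePow (ofRealForm η) g = c • volumeForm Φ e)
    (hc0 : c ≠ 0) {i t : ℕ} (hit : i + t = g) (e₁ : Fin ((i + 2 * t) + i) ≃ ι) :
    ∃ γ ∈ divisorClasses (prodPeriod Φ Φ) i,
      ((-1) ^ i * Nat.factorial g / c : ℂ) • corrAct Φ Φ e₁ (γ.domDomCongr (finCongr (two_mul i))) =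
        kleimanDualPow η i t := by
  refine ⟨_, hη.schollF_apply_mem_divisorClasses Φ (g := g) i, ?_⟩
  rw [← schollF_apply_add_self_eq_domDomCongr]
  exact smul_corrAct_schollF_eq_kleimanDualPow Φ e hc hc0 hnd hit e₁

/-- **The polarised case, printed normalisation**: for a polarised complex torus (abelian variety) of type
`(d₁, …, d_g)` with Riemann form `η`, `ω = c₁(L) = ofRealForm (-η)`, and `i + t = g`:
`Λ^{g-i} = ((-1)ⁱ/(d₁⋯d_g)) · γ(·)` for the explicit divisor class `γ = (f_i)_{2i} ∈ Dⁱ(X × X)`.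
[cite: Milne1999LefschetzClasses, §5 Rem. 5.11] -/
theorem IsRiemannForm.exists_mem_divisorClasses_smul_corrAct_eq_kleimanDualPow (hη : IsRiemannForm Φ η)
    {d : Fin g → ℕ} (hd : IsPolarizationType Φ η d) {i t : ℕ} (hit : i + t = g)
    (e₁ : Fin ((i + 2 * t) + i) ≃ ι) :
    ∃ γ ∈ divisorClasses (prodPeriod Φ Φ) i,
      ((-1 : ℂ) ^ i / ∏ k, (d k : ℂ)) • corrAct Φ Φ e₁ (γ.domDomCongr (finCongr (two_mul i))) =
        kleimanDualPow (-η) i t := by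
  refine ⟨_, (isNSForm_neg' Φ hη.isNSForm).schollF_apply_mem_divisorClasses Φ (g := g) i, ?_⟩
  rw [← schollF_apply_add_self_eq_domDomCongr]
  exact hη.smul_corrAct_schollF_eq_kleimanDualPow Φ hd hit e₁

end Kleiman

end ComplexTorus

end Literature.Geometry.Kaehler
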